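import Summits.ABC.StewartYu.ArchG3Levels
import Summits.ABC.StewartYu.ArchG3KStepDeltaD
import HarnessLib

/-!
# Cell abc-stewartyu, rung A1.L (crux r2 `ArchCoreRat`), WP-L.A: the k-steps on the archimedean level invariant with a GENERIC MONOMIAL
# DENOMINATOR (ruling R34 / R34-implementation, vehicle file 2)

`Summits/ABC/StewartYu/ArchG3LevelsD.lean` — cell `abc-stewartyu` (HOME `run/shared/lean/pub/abc-stewartyu/`; seat lp-1 g8).  Theorems on
`ArchG3Setup.ArchLvInv`; no definition, no named fact.  Sequel of `ArchG3Levels` (✓) and `ArchG3KStepDeltaD`: `ArchLvInv.kstepD` /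
`ArchLvInv.kstep_oddD` = `kstep` / `kstep_odd` with the monomial clearing `Dm x · ∏ⱼ αⱼ^{vᵢⱼ x} ∈ ℤ` as a hypothesis (`Dm : ℤ → ℕ`,
`Dm ≥ 1`) and the inequality against `1/(den₀ a x₁ · Dm x₁)`; `monDen(α, L|x₁|)` is the `N = 1` instance, the virtual denominator of the
saturated data (seat p5) the one-stage instance (R32 (a)).

WHAT THIS IS NOT: no change to `ArchG3Levels`; no choice of `Dm`; no crux moves.

References: Yu. V. Nesterenko, LNM 1819 (2003) §4.2 Lemma 4.3 (4.24)–(4.35) p. 84–90, §3.4 (3.41)–(3.44) p. 105–107 [Nesterenko2003];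
K. Yu, Acta Math. 211 (2013) Lemma 5.2 [Yu2013].
-/

noncomputable section

open Finset Polynomial
open Literature.NumberTheory.Transcendental
open Literature.NumberTheory.Transcendental.CW77.Setup (Tau tauNorm)
open scoped Nat

namespace Summit.ABC.StewartYu

namespace ArchG3Setup

variable (S : ArchG3Setup) {ι : Type*}

variable {S} {R : ι → ℚ[X]} {B : Finset ι} {v : ι → Fin S.n → ℤ} {pv : ι → ℤ} {lo : Fin S.n → ℤ} {L : Fin S.n → ℕ} {P : ℤ}
  {w γ : ℝ} {c : ℤ} {e : Fin S.n → ℤ} {Xs : Set ℤ} {T : ℕ}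

namespace ArchLvInv

/-- **The k-step on the archimedean invariant with a GENERIC MONOMIAL DENOMINATOR** (symmetric nodes): as `ArchLvInv.kstep`, with the
clearing of the monomials `Dm x · ∏ⱼ αⱼ^{vᵢⱼ x} ∈ ℤ` (`|x| ≤ N′`, `i ∈ B`) as a hypothesis and the numerical inequality against
`1/(den₀ a x₁ · Dm x₁)` (R34: at `S(θ)` the record supplies the virtual, α-charged `Dm`). [cite: Nesterenko2003, §4.2 Lemma 4.3, (4.24)–(4.35),
p. 84–90; §3.4 (3.43)–(3.44), p. 106–107] -/
theorem kstepD {N : ℕ} (h : S.ArchLvInv R B v pv lo L P w γ c e {x : ℤ | |x| ≤ (N : ℤ)} T) {N' T' t : ℕ} (ht : 1 ≤ t)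
    (hT : T' + t ≤ T) (hN' : N' ≤ 3 * N + 2)
    {Bc : ℝ} (hBc : (B.card : ℝ) ≤ Bc)
    {A : Fin S.n → ℝ} (hA : ∀ k, |S.lg k| ≤ A k)
    {Γ : Fin S.n → ℝ} (hΓ0 : ∀ k, 0 ≤ Γ k) (hΓ : ∀ i ∈ B, ∀ k, |(S.zγ (v i) k : ℝ)| ≤ Γ k)
    {PΔ : ℝ} (hPΔ0 : 0 ≤ PΔ)
    (hPΔ : ∀ (a : ℕ) (μ : Fin S.n → ℕ), a + ∑ k, μ k < T' → ∀ i ∈ B, |(S.pvΔ v pv c e μ i : ℝ)| ≤ PΔ)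
    {E : ℝ} (hE : 1 ≤ E)
    {Wd : ℝ} (hWd : ∀ i ∈ B, ∀ a < T', ∀ z : ℂ, ‖z‖ ≤ (3 * E + 1) * (2 * N + 1) + N → ‖(hw R i a).eval z‖ ≤ Wd)
    {Wn : ℝ} (hWn0 : 0 ≤ Wn)
    (hWn : ∀ i ∈ B, ∀ t₀ < T, ∀ x : ℤ, |x| ≤ 3 * (N : ℤ) + 2 → |(((hasseDeriv t₀ (R i)).eval (x : ℚ) : ℚ) : ℝ)| ≤ Wn)
    (hw0 : 0 ≤ w) {δ₀ : ℝ} (hΛ : |S.Λ / (S.b S.j₀ : ℝ)| ≤ δ₀)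
    (hsmall : (L S.j₀ : ℝ) * δ₀ * (3 * N + 2) ≤ 1) {C : ℝ} (hC : 1 ≤ C)
    (den₀ : ℕ → ℤ → ℕ) (hden₀ : ∀ a x, 1 ≤ den₀ a x)
    (hR : ∀ a < T', ∀ x : ℤ, |x| ≤ (N' : ℤ) → ∀ i ∈ B, ∃ z₀ : ℤ, (den₀ a x : ℚ) * (hasseDeriv a (R i)).eval (x : ℚ) = z₀)
    (Dm : ℤ → ℕ) (hDm : ∀ x, 1 ≤ Dm x)
    (hmon : ∀ x : ℤ, |x| ≤ (N' : ℤ) → ∀ i ∈ B, ∃ z₂ : ℤ, (Dm x : ℚ) * ∏ j, S.α j ^ (v i j * x) = z₂)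
    (hfinal : ∀ x₁ : ℤ, |x₁| ≤ (N' : ℤ) → ∀ (a : ℕ) (μ : Fin S.n → ℕ), a + ∑ k, μ k < T' →
      Real.exp (|γ| * N') *
        (2 * ((2 * N + 1 : ℕ) : ℝ) ^ (t + 1) * t * (20 * Real.exp 1) ^ ((2 * N + 1) * t) *
            ((2 * C) ^ t * Real.exp (|γ| * (N + 1)) *
              ((2 : ℝ) ^ a * Real.exp ((∑ k, A k * Γ k) / C) *
                (Bc * PΔ * Wn * Real.exp ((|γ| + w) * N) * (2 * ((L S.j₀ : ℝ) * δ₀ * N))))) +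
          Bc * PΔ * Wd * Real.exp ((w + (L S.j₀ : ℝ) * δ₀) * ((3 * E + 1) * (2 * N + 1) + N)) *
            (1 / E) ^ ((2 * N + 1) * t)) +
        Bc * PΔ * Wn * Real.exp ((|γ| + w) * N') * (2 * ((L S.j₀ : ℝ) * δ₀ * N')) <
      1 / ((den₀ a x₁ * Dm x₁ : ℕ) : ℝ)) :
    S.ArchLvInv R B v pv lo L P w γ c e {x : ℤ | |x| ≤ (N' : ℤ)} T' := by
  refine ⟨h.nonzero, h.bound, h.lo_le, h.box, h.slab, h.c_ne, fun x₁ hx₁ a μ haμ => ?_⟩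
  have hL0 : 0 ≤ |γ| + w := by positivity
  have hδ : 0 ≤ |S.Λ / (S.b S.j₀ : ℝ)| := abs_nonneg _
  have hδ₀ : 0 ≤ δ₀ := hδ.trans hΛ
  have hV0 : (0 : ℝ) ≤ (L S.j₀ : ℝ) := Nat.cast_nonneg _
  have hV₀ : ∀ i ∈ B, |(v i S.j₀ : ℝ)| ≤ (L S.j₀ : ℝ) := fun i hi => by exact_mod_cast h.abs_le i hi S.j₀
  have hN0 : (0 : ℝ) ≤ 3 * N + 2 := by positivity
  have hsmall' : (L S.j₀ : ℝ) * |S.Λ / (S.b S.j₀ : ℝ)| * (3 * N + 2) ≤ 1 :=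
    le_trans (mul_le_mul_of_nonneg_right (mul_le_mul_of_nonneg_left hΛ hV0) hN0) hsmall
  have hEm : ∀ i ∈ B, |S.E (v i) - γ| ≤ w + (L S.j₀ : ℝ) * δ₀ := fun i hi =>
    (h.abs_E_sub_le hV₀ i hi).trans (by nlinarith [mul_le_mul_of_nonneg_left hΛ hV0])
  have hBc0 : (0 : ℝ) ≤ B.card := Nat.cast_nonneg _
  refine S.kstep_delta_symmD R v B pv h.c_ne e hN' ht (fun x hx a' μ' h' => h.vanish x hx a' μ' h') (by omega) x₁ hx₁ hA hΓ0 hΓ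
    hPΔ0 (hPΔ a μ haμ) hE γ (fun i hi z hz => hWd i hi a (by omega) z hz) hWn0 hWn hL0 h.abs_Lsum_le hV0 hV₀ hsmall'
    hEm hC (hden₀ a x₁) (hR a (by omega) x₁ hx₁) (hDm x₁) (hmon x₁ hx₁) (lt_of_le_of_lt ?_ (hfinal x₁ hx₁ a μ haμ))
  have hWd0 : 0 ≤ Wd := by
    obtain ⟨i₀, hi₀, _⟩ := h.nonzero
    exact le_trans (norm_nonneg _) (hWd i₀ hi₀ a (by omega) 0 (by simp; positivity))
  have hBc0' : (0 : ℝ) ≤ Bc := hBc0.trans hBc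
  gcongr

/-- **The first k-step of a level with a GENERIC MONOMIAL DENOMINATOR** (odd nodes): as `ArchLvInv.kstep_odd`, denominators as in
`kstepD`. [cite: Nesterenko2003, §4.2 Lemma 4.3 with the nodes 𝒳_{s,0}, p. 84–90] -/
theorem kstep_oddD {m : ℕ} (h : S.ArchLvInv R B v pv lo L P w γ c e {x : ℤ | Odd x ∧ |x| ≤ 2 * (m : ℤ) - 1} T) {N' T' t : ℕ}
    (hm : 1 ≤ m) (ht : 1 ≤ t) (hT : T' + t ≤ T) (hN' : N' ≤ 6 * m)
    {Bc : ℝ} (hBc : (B.card : ℝ) ≤ Bc)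
    {A : Fin S.n → ℝ} (hA : ∀ k, |S.lg k| ≤ A k)
    {Γ : Fin S.n → ℝ} (hΓ0 : ∀ k, 0 ≤ Γ k) (hΓ : ∀ i ∈ B, ∀ k, |(S.zγ (v i) k : ℝ)| ≤ Γ k)
    {PΔ : ℝ} (hPΔ0 : 0 ≤ PΔ)
    (hPΔ : ∀ (a : ℕ) (μ : Fin S.n → ℕ), a + ∑ k, μ k < T' → ∀ i ∈ B, |(S.pvΔ v pv c e μ i : ℝ)| ≤ PΔ)
    {E : ℝ} (hE : 1 ≤ E)
    {Wd : ℝ} (hWd : ∀ i ∈ B, ∀ a < T', ∀ z : ℂ, ‖z‖ ≤ (12 * E + 6) * m → ‖(hw R i a).eval z‖ ≤ Wd)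
    {Wn : ℝ} (hWn0 : 0 ≤ Wn)
    (hWn : ∀ i ∈ B, ∀ t₀ < T, ∀ x : ℤ, |x| ≤ 6 * (m : ℤ) → |(((hasseDeriv t₀ (R i)).eval (x : ℚ) : ℚ) : ℝ)| ≤ Wn)
    (hw0 : 0 ≤ w) {δ₀ : ℝ} (hΛ : |S.Λ / (S.b S.j₀ : ℝ)| ≤ δ₀)
    (hsmall : (L S.j₀ : ℝ) * δ₀ * (6 * m) ≤ 1) {C : ℝ} (hC : 1 ≤ C)
    (den₀ : ℕ → ℤ → ℕ) (hden₀ : ∀ a x, 1 ≤ den₀ a x)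
    (hR : ∀ a < T', ∀ x : ℤ, |x| ≤ (N' : ℤ) → ∀ i ∈ B, ∃ z₀ : ℤ, (den₀ a x : ℚ) * (hasseDeriv a (R i)).eval (x : ℚ) = z₀)
    (Dm : ℤ → ℕ) (hDm : ∀ x, 1 ≤ Dm x)
    (hmon : ∀ x : ℤ, |x| ≤ (N' : ℤ) → ∀ i ∈ B, ∃ z₂ : ℤ, (Dm x : ℚ) * ∏ j, S.α j ^ (v i j * x) = z₂)
    (hfinal : ∀ x₁ : ℤ, |x₁| ≤ (N' : ℤ) → ∀ (a : ℕ) (μ : Fin S.n → ℕ), a + ∑ k, μ k < T' →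
      Real.exp (|γ| * N') *
        (2 * ((2 * m : ℕ) : ℝ) ^ (t + 1) * t * (20 * Real.exp 1) ^ ((2 * m) * t) *
            (2 ^ t * ((2 * C) ^ t * Real.exp (|γ| * (2 * m)) *
              ((2 : ℝ) ^ a * Real.exp ((∑ k, A k * Γ k) / C) *
                (Bc * PΔ * Wn * Real.exp ((|γ| + w) * ((2 * m - 1 : ℕ) : ℝ)) *
                  (2 * ((L S.j₀ : ℝ) * δ₀ * ((2 * m - 1 : ℕ) : ℝ))))))) +
          Bc * PΔ * Wd * Real.exp ((w + (L S.j₀ : ℝ) * δ₀) * ((12 * E + 6) * m)) * (1 / E) ^ ((2 * m) * t)) +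
        Bc * PΔ * Wn * Real.exp ((|γ| + w) * N') * (2 * ((L S.j₀ : ℝ) * δ₀ * N')) <
      1 / ((den₀ a x₁ * Dm x₁ : ℕ) : ℝ)) :
    S.ArchLvInv R B v pv lo L P w γ c e {x : ℤ | |x| ≤ (N' : ℤ)} T' := by
  refine ⟨h.nonzero, h.bound, h.lo_le, h.box, h.slab, h.c_ne, fun x₁ hx₁ a μ haμ => ?_⟩
  have hL0 : 0 ≤ |γ| + w := by positivity
  have hδ : 0 ≤ |S.Λ / (S.b S.j₀ : ℝ)| := abs_nonneg _
  have hδ₀ : 0 ≤ δ₀ := hδ.trans hΛ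
  have hV0 : (0 : ℝ) ≤ (L S.j₀ : ℝ) := Nat.cast_nonneg _
  have hV₀ : ∀ i ∈ B, |(v i S.j₀ : ℝ)| ≤ (L S.j₀ : ℝ) := fun i hi => by exact_mod_cast h.abs_le i hi S.j₀
  have hm0 : (0 : ℝ) ≤ 6 * m := by positivity
  have hsmall' : (L S.j₀ : ℝ) * |S.Λ / (S.b S.j₀ : ℝ)| * (6 * m) ≤ 1 :=
    le_trans (mul_le_mul_of_nonneg_right (mul_le_mul_of_nonneg_left hΛ hV0) hm0) hsmall
  have hEm : ∀ i ∈ B, |S.E (v i) - γ| ≤ w + (L S.j₀ : ℝ) * δ₀ := fun i hi =>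
    (h.abs_E_sub_le hV₀ i hi).trans (by nlinarith [mul_le_mul_of_nonneg_left hΛ hV0])
  have hBc0 : (0 : ℝ) ≤ B.card := Nat.cast_nonneg _
  refine S.kstep_delta_oddD R v B pv h.c_ne e hm hN' ht (fun x hxo hx a' μ' h' => h.vanish x ⟨hxo, hx⟩ a' μ' h') (by omega)
    x₁ hx₁ hA hΓ0 hΓ hPΔ0 (hPΔ a μ haμ) hE γ (fun i hi z hz => hWd i hi a (by omega) z hz) hWn0 hWn hL0 h.abs_Lsum_le hV0 hV₀
    hsmall' hEm hC (hden₀ a x₁) (hR a (by omega) x₁ hx₁) (hDm x₁) (hmon x₁ hx₁) (lt_of_le_of_lt ?_ (hfinal x₁ hx₁ a μ haμ))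
  have hWd0 : 0 ≤ Wd := by
    obtain ⟨i₀, hi₀, _⟩ := h.nonzero
    exact le_trans (norm_nonneg _) (hWd i₀ hi₀ a (by omega) 0 (by simp; positivity))
  have hBc0' : (0 : ℝ) ≤ Bc := hBc0.trans hBc
  gcongr

end ArchLvInv

end ArchG3Setup

end Summit.ABC.StewartYu

end
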